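import Mathlib.Tactic
import HarnessLib

/-!
# The free-segment flip count `D(r) = 1` (PROOFS §P70 (o) CASE 2b, §P70 (p) «γ = c_W», §P71 (c); BENCH M2-R108/M2-R109/M2-R111)

Support file (`--supports stmt-CriticalPhenomena-4575`), prover seat `prim-rate-mine-2` (lane prim-rate, constants-miner (c);
`run/shared/lean/prim/prim-rate/prim-rate-mine-2/PROOFS.md` §P70 (o)).  No definitions, no named facts, no sorries; standard axioms.

SETTING.  In the step lemma of THEOREM T2 (chorded fans) and in the explicit constants of the TWO-ARM THEOREM, the doubly-pivotal colourings of
CASE 2b leave a FREE hub–path segment `u = w₀ – w₁ – … – w_k` (path pairs `t₀,…,t_{k−1}`, `t_i = w_i w_{i+1}`; spokes `s₀,…,s_k`, `s_i = x w_i`)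
whose far end `w_k` is attached to the BLUE cluster `L⁰` of `x` from beyond (through a blue pair) and to nothing red.  Then
`u ∈ R⁰` («u red-joined to x») iff u's red run carries a red spoke: `∃ i, s_i red ∧ t_0 … t_{i−1} red`, and
`u ∈ L⁰` iff u's blue run carries a blue spoke OR reaches `w_k`: `(∃ i, s_i blue ∧ t_0 … t_{i−1} blue) ∨ (all t blue)`.
The lemma «`D(r) = 1`» says that over the `2^{2k+1}` colourings of the segment, `Σ ([u ∈ L⁰] − [u ∈ R⁰]) = 1`:
the colour flip matches «red run with a red spoke» with «blue run with a blue spoke», and exactly ONE colouring — all pairs blue, all spokes red —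
has `u ∈ L⁰` through the far end only.  Colours are Booleans (`true` = red).

* `CSH.segmentFlip_count` — `Σ_{t : Fin k → Bool, s : Fin (k+1) → Bool} ([blueReach t s] − [redReach t s]) = 1`.
[cite: VandenbergHaggstromKahn2005, Thm. 1.3 (p. 6)] [cite: Harris1960, Lemma 4.1 (p. 16)]
-/

namespace Summit.CriticalPhenomena.PercolationContinuityZ3.Theorems.CSH

open Finset

/-- **The free-segment flip count `D = 1`** (PROOFS §P70 (o) CASE 2b).  For a hub–path segment of `k+1` vertices with path colours
`t : Fin k → Bool` and spoke colours `s : Fin (k+1) → Bool` (`true` = red), whose far end is blue-attached to the blue cluster of `x`: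
`#{u blue-joined to x} − #{u red-joined to x} = 1`, where `u` is red-joined iff `∃ i, s i ∧ ∀ j < i, t j` (a red spoke on u's red run) and
blue-joined iff `(∃ i, ¬ s i ∧ ∀ j < i, ¬ t j) ∨ (∀ j, ¬ t j)` (a blue spoke on u's blue run, or the run reaches the far end).
Proof: the colour flip is a bijection carrying the red event onto the first disjunct of the blue event; the surplus is the single colouring
«all pairs blue, all spokes red». [cite: Harris1960, Lemma 4.1 (p. 16)] -/
theorem segmentFlip_count (k : ℕ) :
    (∑ c : (Fin k → Bool) × (Fin (k + 1) → Bool),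
        ((if ((∃ i : Fin (k + 1), c.2 i = false ∧ ∀ j : Fin k, j.val < i.val → c.1 j = false) ∨ (∀ j : Fin k, c.1 j = false))
            then (1 : ℤ) else 0)
          - (if (∃ i : Fin (k + 1), c.2 i = true ∧ ∀ j : Fin k, j.val < i.val → c.1 j = true) then (1 : ℤ) else 0))) = 1 := by
  classical
  -- the colour flip
  let φ : (Fin k → Bool) × (Fin (k + 1) → Bool) ≃ (Fin k → Bool) × (Fin (k + 1) → Bool) :=
    { toFun := fun c => (fun j => !c.1 j, fun i => !c.2 i)
      invFun := fun c => (fun j => !c.1 j, fun i => !c.2 i)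
      left_inv := fun c => by ext <;> simp
      right_inv := fun c => by ext <;> simp }
  -- red event of the flipped colouring = «blue spoke on the blue run» event
  have hflip : ∀ c : (Fin k → Bool) × (Fin (k + 1) → Bool),
      (∃ i : Fin (k + 1), (φ c).2 i = true ∧ ∀ j : Fin k, j.val < i.val → (φ c).1 j = true) ↔
      (∃ i : Fin (k + 1), c.2 i = false ∧ ∀ j : Fin k, j.val < i.val → c.1 j = false) := by
    intro c
    simp only [φ, Equiv.coe_fn_mk, Bool.not_eq_true']
  -- rewrite the red sum through the flip
  have hred : (∑ c : (Fin k → Bool) × (Fin (k + 1) → Bool),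
        (if (∃ i : Fin (k + 1), c.2 i = true ∧ ∀ j : Fin k, j.val < i.val → c.1 j = true) then (1 : ℤ) else 0))
      = ∑ c : (Fin k → Bool) × (Fin (k + 1) → Bool),
        (if (∃ i : Fin (k + 1), c.2 i = false ∧ ∀ j : Fin k, j.val < i.val → c.1 j = false) then (1 : ℤ) else 0) := by
    rw [← Equiv.sum_comp φ]
    refine Finset.sum_congr rfl fun c _ => ?_
    rw [if_congr (hflip c) rfl rfl]
  rw [Finset.sum_sub_distrib, hred, ← Finset.sum_sub_distrib]
  -- pointwise: [B' ∨ allblue] − [B'] = [allblue ∧ ¬B'] = [all t false ∧ all s true]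
  have hpt : ∀ c : (Fin k → Bool) × (Fin (k + 1) → Bool),
      ((if ((∃ i : Fin (k + 1), c.2 i = false ∧ ∀ j : Fin k, j.val < i.val → c.1 j = false) ∨ (∀ j : Fin k, c.1 j = false))
          then (1 : ℤ) else 0)
        - (if (∃ i : Fin (k + 1), c.2 i = false ∧ ∀ j : Fin k, j.val < i.val → c.1 j = false) then (1 : ℤ) else 0))
      = if c = (fun _ => false, fun _ => true) then (1 : ℤ) else 0 := by
    intro c
    by_cases hB : ∃ i : Fin (k + 1), c.2 i = false ∧ ∀ j : Fin k, j.val < i.val → c.1 j = false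
    · have h1 : ((∃ i : Fin (k + 1), c.2 i = false ∧ ∀ j : Fin k, j.val < i.val → c.1 j = false) ∨
          (∀ j : Fin k, c.1 j = false)) := Or.inl hB
      rw [if_pos h1, if_pos hB]
      have hne : c ≠ (fun _ => false, fun _ => true) := by
        rintro rfl
        obtain ⟨i, hi, -⟩ := hB
        simp at hi
      rw [if_neg hne]; ring
    · rw [if_neg hB]
      by_cases hall : ∀ j : Fin k, c.1 j = false
      · have h1 : ((∃ i : Fin (k + 1), c.2 i = false ∧ ∀ j : Fin k, j.val < i.val → c.1 j = false) ∨
            (∀ j : Fin k, c.1 j = false)) := Or.inr hall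
        rw [if_pos h1]
        -- then all spokes are red (else hB), so c is the special colouring
        have hs : ∀ i : Fin (k + 1), c.2 i = true := by
          intro i
          by_contra hsi
          exact hB ⟨i, by simpa using hsi, fun j _ => hall j⟩
        have hc : c = (fun _ => false, fun _ => true) := by
          ext j
          · simpa using hall j
          · simpa using hs j
        rw [if_pos hc]; ring
      · have h1 : ¬ ((∃ i : Fin (k + 1), c.2 i = false ∧ ∀ j : Fin k, j.val < i.val → c.1 j = false) ∨
            (∀ j : Fin k, c.1 j = false)) := by
          rintro (h | h); exact hB h; exact hall h
        rw [if_neg h1]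
        have hne : c ≠ (fun _ => false, fun _ => true) := by
          rintro rfl; exact hall (fun j => rfl)
        rw [if_neg hne]; ring
  rw [Finset.sum_congr rfl fun c _ => hpt c]
  rw [Finset.sum_ite_eq' Finset.univ (fun _ => false, fun _ => true)]
  simp

end Summit.CriticalPhenomena.PercolationContinuityZ3.Theorems.CSH
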